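import Literature.AlgebraicGeometry.Motives.GaloisDescentFunctor
import HarnessLib

/-!
# Effective Galois descent of diagrams, II: EXTRA equivariant morphisms between two descended diagrams descend
# (Görtz–Wedhorn I, Thm. 14.72 (1) between the `k`-forms of Thm. 14.83 / Cor. 14.85)

Continuation of `GaloisDescentFunctor.lean`.  There a diagram `X : J ⥤ SchemeOver L` with a natural semilinear `Gal(L/k)`-action
(`D : GaloisDescentFunctor.Datum k X`) was descended to `D.descendedFunctor L : J ⥤ SchemeOver k` with equivariant identifications
`D.iso L j : X j ≅ (X₀ j) ×_k Spec L`.  In the application (towers of Shimura varieties) a tower carries MORE equivariant maps than its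
transition maps — the Hecke correspondences `T_g : M_K → M_{K′}` for `g⁻¹ K g ⊆ K′` are not indexed by morphisms of the level poset —
and a second tower (another model) may have to be compared with the first.  This file descends all of them at once:

* for TWO data `D : Datum k X`, `D′ : Datum k X′` over diagrams `X : J ⥤ SchemeOver L`, `X′ : J′ ⥤ SchemeOver L` (the index
  categories may differ) and an `L`-morphism `φ : X i ⟶ X′ i′` that is EQUIVARIANT (`ρ_i σ ≫ φ = φ ≫ ρ′_{i′} σ`), the transported
  morphism `homL φ = e_i⁻¹ ≫ φ ≫ e′_{i′} : (X₀ i)_L → (X₀′ i′)_L` commutes with the Galois automorphisms (`gal_comp_homL_left`), hence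
  descends UNIQUELY to **`descHom φ hφ : X₀ i ⟶ X₀′ i′`** over `k` (`GaloisDescent.descentOver`; `bcFunctor_map_descHom`,
  `iso_hom_comp_map_descHom`, `eq_descHom_of_map_eq`, `eq_descHom_of_comm`);
* `descHom` is functorial (`descHom_id`, `descHom_comp` across three data) and recovers the descended transition maps
  (`map₀_eq_descHom`);
* COMMUTING SQUARES of equivariant maps descend to commuting squares (`descHom_comp_eq_of_comp_eq`: faithfulness of base change) —
  e.g. «`T_g` commutes with the transition maps» passes to the `k`-forms.

Definitions with bodies (`homL`, `descHom`) and theorems only: NO named fact, NO instance, NO `sorry`; net Literature debt 0.  Generic (no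
Shimura imports); HC_CM is not proved here.  Consumer: the cell hodgecm-mathlib, row I-6 (`descentToIntersection_printed`), piece D2.

## References
* U. Görtz, T. Wedhorn, *Algebraic Geometry I: Schemes*, 2nd ed. (2020): §(14.20), Thm. 14.72 (1), Thm. 14.83, Cor. 14.85. [GortzWedhorn2020]
* J. S. Milne, *Introduction to Shimura varieties* (2005), §13 p. 118 L21–28 and Thm. 13.6 (the `T(g)` are defined over the reflex
  field: the morphisms one wants to descend with the tower). [Milne2005ShimuraVarieties]
* Tree: `Motives.GaloisDescentFunctor` (`Datum`, `obj₀`, `iso`, `aut_hom_iso_hom_left`, `gal_iso_inv_left`, `isReduced_bc_obj₀`,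
  `locallyOfFiniteType_obj₀`, `isSeparated_obj₀`, `map₀`, `mapL`), `Motives.JacobianGaloisDescent` (`GaloisDescent.descentOver`,
  `bcFunctor_map_descentOver`), `Motives.AbelianVarietyEndGaloisDescent` (`AbelianVariety.bcFunctor_map_injective`).
-/

set_option autoImplicit false

noncomputable section

open CategoryTheory CategoryTheory.Limits AlgebraicGeometry
open Literature.AlgebraicGeometry.RelativeSpec

universe v v' v'' w w' w'' u

namespace Literature.AlgebraicGeometry.Motives

namespace GaloisDescentFunctor

namespace Datum

open AbelianVariety (bcSpec bcFunctor specAut bcFunctor_map_injective)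

set_option backward.isDefEq.respectTransparency false

variable {k : Type u} [Field k] (L : Type u) [Field L] [Algebra k L]
variable {J : Type w} [Category.{v} J] {J' : Type w'} [Category.{v'} J'] {J'' : Type w''} [Category.{v''} J'']
variable {X : J ⥤ SchemeOver L} {X' : J' ⥤ SchemeOver L} {X'' : J'' ⥤ SchemeOver L}
variable (D : Datum k X) (D' : Datum k X') (D'' : Datum k X'')
variable [FiniteDimensional k L] [IsGalois k L]

/-! ## §1 Transport of an `L`-morphism `X i → X′ i′` to the `k`-forms, base-changed -/

/-- The `L`-morphism `φ : X i → X′ i′` transported to `(X₀ i)_L → (X₀′ i′)_L` along the identifications: `e_i⁻¹ ≫ φ ≫ e′_{i′}`.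
[cite: GortzWedhorn2020, §(14.20) and Thm. 14.72 (1)] -/
def homL {i : J} {i' : J'} (φ : X.obj i ⟶ X'.obj i') :
    (bcFunctor k L).obj (D.obj₀ L i) ⟶ (bcFunctor k L).obj (D'.obj₀ L i') :=
  (D.iso L i).inv ≫ φ ≫ (D'.iso L i').hom

/-- Unfolding of `homL`. [cite: GortzWedhorn2020, Thm. 14.72 (1)] -/
theorem homL_def {i : J} {i' : J'} (φ : X.obj i ⟶ X'.obj i') :
    D.homL L D' φ = (D.iso L i).inv ≫ φ ≫ (D'.iso L i').hom := rfl

/-- `homL` of an identity is the identity. [cite: GortzWedhorn2020, Thm. 14.72 (1)] -/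
theorem homL_id (i : J) : D.homL L D (𝟙 (X.obj i)) = 𝟙 _ := by
  rw [homL_def, Category.id_comp, Iso.inv_hom_id]

/-- `homL` of a composite is the composite (across three data). [cite: GortzWedhorn2020, Thm. 14.72 (1)] -/
theorem homL_comp {i : J} {i' : J'} {i'' : J''} (φ : X.obj i ⟶ X'.obj i') (ψ : X'.obj i' ⟶ X''.obj i'') :
    D.homL L D'' (φ ≫ ψ) = D.homL L D' φ ≫ D'.homL L D'' ψ := by
  simp only [homL_def, Category.assoc, Iso.hom_inv_id_assoc]

/-- `homL` of a transition map is `mapL` (by `rfl`). [cite: GortzWedhorn2020, Thm. 14.72 (1)] -/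
theorem homL_map {i j : J} (f : i ⟶ j) : D.homL L D (X.map f) = D.mapL L f := rfl

/-- **An EQUIVARIANT `L`-morphism, transported to the `k`-forms, commutes with the Galois automorphisms** `1 × Spec σ⁻¹`
(equivariance of the identifications on both sides). [cite: GortzWedhorn2020, §(14.20) and Thm. 14.72 (1)] -/
@[reassoc]
theorem gal_comp_homL_left {i : J} {i' : J'} (φ : X.obj i ⟶ X'.obj i')
    (hφ : ∀ σ : L ≃ₐ[k] L, ((D.ρ i).aut σ).hom ≫ φ.left = φ.left ≫ ((D'.ρ i').aut σ).hom) (σ : L ≃ₐ[k] L) :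
    GaloisDescent.gal L (D.obj₀ L i) σ ≫ (D.homL L D' φ).left =
      (D.homL L D' φ).left ≫ GaloisDescent.gal L (D'.obj₀ L i') σ := by
  simp only [homL_def, Over.comp_left, Category.assoc]
  rw [D.gal_iso_inv_left_assoc L i σ, reassoc_of% (hφ σ), D'.aut_hom_iso_hom_left L i' σ]

/-! ## §2 The descended morphism -/

/-- **The descent `X₀ i → X₀′ i′` over `k` of an equivariant `L`-morphism `φ : X i → X′ i′`** (Görtz–Wedhorn I, Thm. 14.72 (1), applied to
`homL φ` between the `k`-forms: `GaloisDescent.descentOver`). [cite: GortzWedhorn2020, Thm. 14.72 (1)] -/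
def descHom {i : J} {i' : J'} (φ : X.obj i ⟶ X'.obj i')
    (hφ : ∀ σ : L ≃ₐ[k] L, ((D.ρ i).aut σ).hom ≫ φ.left = φ.left ≫ ((D'.ρ i').aut σ).hom) :
    D.obj₀ L i ⟶ D'.obj₀ L i' :=
  haveI := D.isReduced_bc_obj₀ L i
  haveI := D.locallyOfFiniteType_obj₀ L i
  haveI := D'.isSeparated_obj₀ L i'
  GaloisDescent.descentOver L (D.homL L D' φ) (D.gal_comp_homL_left L D' φ hφ)

/-- **The base change of the descended morphism is the transported one**: `(descHom φ)_L = e_i⁻¹ ≫ φ ≫ e′_{i′}`.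
[cite: GortzWedhorn2020, Thm. 14.72 (1)] -/
theorem bcFunctor_map_descHom {i : J} {i' : J'} (φ : X.obj i ⟶ X'.obj i')
    (hφ : ∀ σ : L ≃ₐ[k] L, ((D.ρ i).aut σ).hom ≫ φ.left = φ.left ≫ ((D'.ρ i').aut σ).hom) :
    (bcFunctor k L).map (D.descHom L D' φ hφ) = D.homL L D' φ := by
  haveI := D.isReduced_bc_obj₀ L i
  haveI := D.locallyOfFiniteType_obj₀ L i
  haveI := D'.isSeparated_obj₀ L i'
  unfold descHom
  exact GaloisDescent.bcFunctor_map_descentOver L (D.homL L D' φ) (D.gal_comp_homL_left L D' φ hφ)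

/-- **The descended morphism makes the square with the identifications commute**: `e_i ≫ (descHom φ)_L = φ ≫ e′_{i′}`.
[cite: GortzWedhorn2020, Thm. 14.72 (1)] -/
@[reassoc]
theorem iso_hom_comp_map_descHom {i : J} {i' : J'} (φ : X.obj i ⟶ X'.obj i')
    (hφ : ∀ σ : L ≃ₐ[k] L, ((D.ρ i).aut σ).hom ≫ φ.left = φ.left ≫ ((D'.ρ i').aut σ).hom) :
    (D.iso L i).hom ≫ (bcFunctor k L).map (D.descHom L D' φ hφ) = φ ≫ (D'.iso L i').hom := by
  rw [bcFunctor_map_descHom, homL_def, Iso.hom_inv_id_assoc]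

/-- **Uniqueness**: a `k`-morphism whose base change is the transported morphism IS `descHom φ` (base change along `Spec L → Spec k` is
faithful). [cite: GortzWedhorn2020, Thm. 14.72 (1)] -/
theorem eq_descHom_of_map_eq {i : J} {i' : J'} (φ : X.obj i ⟶ X'.obj i')
    (hφ : ∀ σ : L ≃ₐ[k] L, ((D.ρ i).aut σ).hom ≫ φ.left = φ.left ≫ ((D'.ρ i').aut σ).hom)
    (g : D.obj₀ L i ⟶ D'.obj₀ L i') (hg : (bcFunctor k L).map g = D.homL L D' φ) : g = D.descHom L D' φ hφ :=
  bcFunctor_map_injective L (hg.trans (D.bcFunctor_map_descHom L D' φ hφ).symm)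

/-- **Uniqueness, square form**: a `k`-morphism `g` with `e_i ≫ g_L = φ ≫ e′_{i′}` IS `descHom φ`. [cite: GortzWedhorn2020, Thm. 14.72 (1)] -/
theorem eq_descHom_of_comm {i : J} {i' : J'} (φ : X.obj i ⟶ X'.obj i')
    (hφ : ∀ σ : L ≃ₐ[k] L, ((D.ρ i).aut σ).hom ≫ φ.left = φ.left ≫ ((D'.ρ i').aut σ).hom)
    (g : D.obj₀ L i ⟶ D'.obj₀ L i') (hg : (D.iso L i).hom ≫ (bcFunctor k L).map g = φ ≫ (D'.iso L i').hom) :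
    g = D.descHom L D' φ hφ := by
  refine D.eq_descHom_of_map_eq L D' φ hφ g ?_
  rw [homL_def, ← hg, Iso.inv_hom_id_assoc]

/-- `descHom` does not depend on the equivariance witness. [cite: GortzWedhorn2020, Thm. 14.72 (1)] -/
theorem descHom_congr {i : J} {i' : J'} {φ ψ : X.obj i ⟶ X'.obj i'} (e : φ = ψ)
    (hφ : ∀ σ : L ≃ₐ[k] L, ((D.ρ i).aut σ).hom ≫ φ.left = φ.left ≫ ((D'.ρ i').aut σ).hom)
    (hψ : ∀ σ : L ≃ₐ[k] L, ((D.ρ i).aut σ).hom ≫ ψ.left = ψ.left ≫ ((D'.ρ i').aut σ).hom) :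
    D.descHom L D' φ hφ = D.descHom L D' ψ hψ := by
  subst e
  rfl

/-! ## §3 Functoriality and compatibility with the descended transition maps -/

omit [FiniteDimensional k L] [IsGalois k L] in
/-- Identities are equivariant. [cite: GortzWedhorn2020, §(14.20)] -/
theorem equivariant_id (i : J) (σ : L ≃ₐ[k] L) :
    ((D.ρ i).aut σ).hom ≫ (𝟙 (X.obj i) : X.obj i ⟶ X.obj i).left = (𝟙 (X.obj i) : X.obj i ⟶ X.obj i).left ≫ ((D.ρ i).aut σ).hom := by
  rw [Over.id_left, Category.comp_id, Category.id_comp]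

omit [FiniteDimensional k L] [IsGalois k L] in
/-- Composites of equivariant morphisms are equivariant. [cite: GortzWedhorn2020, §(14.20)] -/
theorem equivariant_comp {i : J} {i' : J'} {i'' : J''} (φ : X.obj i ⟶ X'.obj i') (ψ : X'.obj i' ⟶ X''.obj i'')
    (hφ : ∀ σ : L ≃ₐ[k] L, ((D.ρ i).aut σ).hom ≫ φ.left = φ.left ≫ ((D'.ρ i').aut σ).hom)
    (hψ : ∀ σ : L ≃ₐ[k] L, ((D'.ρ i').aut σ).hom ≫ ψ.left = ψ.left ≫ ((D''.ρ i'').aut σ).hom) (σ : L ≃ₐ[k] L) :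
    ((D.ρ i).aut σ).hom ≫ (φ ≫ ψ).left = (φ ≫ ψ).left ≫ ((D''.ρ i'').aut σ).hom := by
  rw [Over.comp_left, reassoc_of% (hφ σ), hψ σ, Category.assoc]

/-- **`descHom` of an identity is the identity.** [cite: GortzWedhorn2020, Thm. 14.72 (1)] -/
theorem descHom_id (i : J) : D.descHom L D (𝟙 (X.obj i)) (D.equivariant_id L i) = 𝟙 (D.obj₀ L i) :=
  (D.eq_descHom_of_map_eq L D (𝟙 (X.obj i)) (D.equivariant_id L i) (𝟙 _)
    (by rw [CategoryTheory.Functor.map_id, homL_id])).symm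

/-- **`descHom` of a composite is the composite** (across three data / diagrams). [cite: GortzWedhorn2020, Thm. 14.72 (1)] -/
theorem descHom_comp {i : J} {i' : J'} {i'' : J''} (φ : X.obj i ⟶ X'.obj i') (ψ : X'.obj i' ⟶ X''.obj i'')
    (hφ : ∀ σ : L ≃ₐ[k] L, ((D.ρ i).aut σ).hom ≫ φ.left = φ.left ≫ ((D'.ρ i').aut σ).hom)
    (hψ : ∀ σ : L ≃ₐ[k] L, ((D'.ρ i').aut σ).hom ≫ ψ.left = ψ.left ≫ ((D''.ρ i'').aut σ).hom) :
    D.descHom L D'' (φ ≫ ψ) (D.equivariant_comp L D' D'' φ ψ hφ hψ) = D.descHom L D' φ hφ ≫ D'.descHom L D'' ψ hψ :=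
  (D.eq_descHom_of_map_eq L D'' (φ ≫ ψ) (D.equivariant_comp L D' D'' φ ψ hφ hψ) _
    (by rw [CategoryTheory.Functor.map_comp, bcFunctor_map_descHom, bcFunctor_map_descHom, homL_comp])).symm

/-- **The descended transition maps are `descHom` of the transition maps**: `map₀ f = descHom (X.map f)`.
[cite: GortzWedhorn2020, Thm. 14.72 (1)] -/
theorem map₀_eq_descHom {i j : J} (f : i ⟶ j) : D.map₀ L f = D.descHom L D (X.map f) (D.natural f) :=
  D.eq_descHom_of_map_eq L D (X.map f) (D.natural f) _ (by rw [bcFunctor_map_map₀, homL_map])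

/-- The maps of the descended functor are `descHom` of the transition maps. [cite: GortzWedhorn2020, Thm. 14.72 (1)] -/
theorem descendedFunctor_map_eq_descHom {i j : J} (f : i ⟶ j) :
    (D.descendedFunctor L).map f = D.descHom L D (X.map f) (D.natural f) :=
  D.map₀_eq_descHom L f

/-! ## §4 Commuting squares of equivariant maps descend -/

/-- **Commuting squares descend**: if equivariant `L`-morphisms satisfy `φ ≫ ψ′ = ψ ≫ φ′` (e.g. a Hecke correspondence commuting with
transition maps, or a comparison of two towers intertwining their transition maps), then so do their descents:
`descHom φ ≫ descHom ψ′ = descHom ψ ≫ descHom φ′` (functoriality of `descHom`, i.e. faithfulness of base change).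
[cite: GortzWedhorn2020, Thm. 14.72 (1)] [cite: Milne2005ShimuraVarieties, §13 Thm. 13.6 p. 118] -/
theorem descHom_comp_eq_of_comp_eq {i : J} {i' j' : J'} {i'' : J''}
    (φ : X.obj i ⟶ X'.obj i') (ψ' : X'.obj i' ⟶ X''.obj i'') (ψ : X.obj i ⟶ X'.obj j') (φ' : X'.obj j' ⟶ X''.obj i'')
    (hφ : ∀ σ : L ≃ₐ[k] L, ((D.ρ i).aut σ).hom ≫ φ.left = φ.left ≫ ((D'.ρ i').aut σ).hom)
    (hψ' : ∀ σ : L ≃ₐ[k] L, ((D'.ρ i').aut σ).hom ≫ ψ'.left = ψ'.left ≫ ((D''.ρ i'').aut σ).hom)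
    (hψ : ∀ σ : L ≃ₐ[k] L, ((D.ρ i).aut σ).hom ≫ ψ.left = ψ.left ≫ ((D'.ρ j').aut σ).hom)
    (hφ' : ∀ σ : L ≃ₐ[k] L, ((D'.ρ j').aut σ).hom ≫ φ'.left = φ'.left ≫ ((D''.ρ i'').aut σ).hom)
    (hsq : φ ≫ ψ' = ψ ≫ φ') :
    D.descHom L D' φ hφ ≫ D'.descHom L D'' ψ' hψ' = D.descHom L D' ψ hψ ≫ D'.descHom L D'' φ' hφ' := by
  rw [← descHom_comp, ← descHom_comp]
  exact D.descHom_congr L D'' hsq _ _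

/-- **Naturality descends** (the case of one equivariant family between two diagrams on the SAME index category intertwining the
transition maps): if `φ_j : X j → X′ j` is equivariant for every `j` and `X.map f ≫ φ_j = φ_i ≫ X′.map f`, then
`map₀ f ≫ descHom φ_j = descHom φ_i ≫ map₀′ f` — the descents form a natural transformation `X₀ ⟶ X₀′`.
[cite: GortzWedhorn2020, Thm. 14.72 (1)] -/
theorem map₀_comp_descHom {X' : J ⥤ SchemeOver L} (D' : Datum k X') (φ : ∀ j : J, X.obj j ⟶ X'.obj j)
    (hφ : ∀ (j : J) (σ : L ≃ₐ[k] L), ((D.ρ j).aut σ).hom ≫ (φ j).left = (φ j).left ≫ ((D'.ρ j).aut σ).hom)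
    (hnat : ∀ ⦃i j : J⦄ (f : i ⟶ j), X.map f ≫ φ j = φ i ≫ X'.map f) {i j : J} (f : i ⟶ j) :
    D.map₀ L f ≫ D.descHom L D' (φ j) (hφ j) = D.descHom L D' (φ i) (hφ i) ≫ D'.map₀ L f := by
  rw [map₀_eq_descHom, map₀_eq_descHom, ← descHom_comp, ← descHom_comp]
  exact D.descHom_congr L D' (hnat f) _ _

/-- **The descended natural transformation** `X₀ ⟶ X₀′` of an equivariant natural family `φ_j : X j → X′ j`.
[cite: GortzWedhorn2020, Thm. 14.72 (1)] -/
def descNatTrans {X' : J ⥤ SchemeOver L} (D' : Datum k X') (φ : ∀ j : J, X.obj j ⟶ X'.obj j)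
    (hφ : ∀ (j : J) (σ : L ≃ₐ[k] L), ((D.ρ j).aut σ).hom ≫ (φ j).left = (φ j).left ≫ ((D'.ρ j).aut σ).hom)
    (hnat : ∀ ⦃i j : J⦄ (f : i ⟶ j), X.map f ≫ φ j = φ i ≫ X'.map f) :
    D.descendedFunctor L ⟶ D'.descendedFunctor L where
  app j := D.descHom L D' (φ j) (hφ j)
  naturality _ _ f := D.map₀_comp_descHom L D' φ hφ hnat f

/-- The components of the descended natural transformation (by `rfl`). [cite: GortzWedhorn2020, Thm. 14.72 (1)] -/
theorem descNatTrans_app {X' : J ⥤ SchemeOver L} (D' : Datum k X') (φ : ∀ j : J, X.obj j ⟶ X'.obj j)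
    (hφ : ∀ (j : J) (σ : L ≃ₐ[k] L), ((D.ρ j).aut σ).hom ≫ (φ j).left = (φ j).left ≫ ((D'.ρ j).aut σ).hom)
    (hnat : ∀ ⦃i j : J⦄ (f : i ⟶ j), X.map f ≫ φ j = φ i ≫ X'.map f) (j : J) :
    (D.descNatTrans L D' φ hφ hnat).app j = D.descHom L D' (φ j) (hφ j) := rfl

/-- **Base change of the descended natural transformation**: whiskered with `(· ×_k Spec L)` and conjugated by the identifications it is
the given family: `ι_j ≫ ((descNatTrans φ).app j)_L = φ_j ≫ ι′_j`. [cite: GortzWedhorn2020, Thm. 14.72 (1), Thm. 14.83 and Cor. 14.85] -/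
theorem isoBaseChange_hom_app_comp_map_descNatTrans_app {X' : J ⥤ SchemeOver L} (D' : Datum k X')
    (φ : ∀ j : J, X.obj j ⟶ X'.obj j)
    (hφ : ∀ (j : J) (σ : L ≃ₐ[k] L), ((D.ρ j).aut σ).hom ≫ (φ j).left = (φ j).left ≫ ((D'.ρ j).aut σ).hom)
    (hnat : ∀ ⦃i j : J⦄ (f : i ⟶ j), X.map f ≫ φ j = φ i ≫ X'.map f) (j : J) :
    (D.isoBaseChange L).hom.app j ≫ (bcFunctor k L).map ((D.descNatTrans L D' φ hφ hnat).app j) =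
      φ j ≫ (D'.isoBaseChange L).hom.app j := by
  rw [descNatTrans_app, isoBaseChange_hom_app, isoBaseChange_hom_app, iso_hom_comp_map_descHom]

end Datum

end GaloisDescentFunctor

end Literature.AlgebraicGeometry.Motives

end
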